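import Summits.ValiantsHypothesis.ValiantsHypothesis.Theorems.BarrierLeverChowBenchmarkPairsSplitCertCanonical
import Summits.ValiantsHypothesis.ValiantsHypothesis.Theorems.BarrierLeverPartitionMinorsChowInverseCertificates

/-!
# Route BarrierLever — item 22038 `ChowBenchmarkPairs`, line `moore-peel`: SPLIT CERTIFICATES with DETERMINANT LEAVES
# (the relaxed leaf check, its soundness, the typed node «every height has a relaxed certificate» and its kernel arrow)

Helper file (`--supports stmt-ValiantsHypothesis-22038`; cell valiant-natproofs, rung V4; seat val-np-p4 gen 25).  Closes NO item.

The certificate format of `…SplitCertDefs` (p661448) ends with the leaf check `leafOK`: after the one-coordinate splits the instance must be a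
DIAGONAL matrix of nonzero naturals («triangular certificate»).  This file relaxes the leaf: after the splits every column code is `0`, so the
instance IS an integer matrix `S = (s_ij)` (all `dirE` factors are `dirE … ∅ = 1`), and ANY certificate of `det S ≠ 0` suffices.  We take the
list-coded inverse certificate modulo `q` of `…ChowInverseCertificates` (`invCertCheck`, `det_ne_zero_of_invCertCheck`, val-np-p4 g12):

* `Cert.scalRows n I` — the scalar matrix of an instance as integer row lists; `Cert.leafOKDet n q LBt I` — all codes `0` and
  `S · LBtᵀ ≡ 1 (mod q)`, `q > 1`; **`Cert.leafDet_sound`** — then the matrix of `I` at the generic table has nonzero determinant;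
* `Cert.checkD k n q LBt levels I` — the SAME levels (`perm` / `split`, checked by the landed `permStep` / `splitStep`) followed by the leaf
  check `leafOK n I || leafOKDet n q LBt I`; **`Cert.det_genTable_ne_zero_of_checkD`**, **`Cert.exists_table_of_checkD`** (soundness, by the
  landed `permStep_sound` / `splitStep_sound` and the new leaf), `Cert.checkD_of_check` (every triangular certificate is a relaxed one),
  `Cert.hsmv_of_checkD` (a relaxed certificate for the homogeneous root gives `HSMVAt h`);
* the TYPED NODE **`Stmt.splitCertDet`**: «for every `h` some levels and some inverse certificate pass `checkD` on the canonical homogeneous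
  root» — WEAKER than `Stmt.splitCertCanon` (`splitCertDet_of_splitCertCanon`), with the kernel ARROW **`segmentMeanValue_of_splitCertDet`**
  to `∀ h, SegmentMeanValueAt h` (the registered stub `stub_segmentMeanValue`, verbatim), via `smv_of_hsmv` (p668821).

WHY (seat finding, val-np-p4 g25, kit j319385): the diagonal leaf is a genuine restriction of the search space, not of the mathematics —
e.g. the 13-row instance `{R_b R_7² (b ≤ 6), R_b R_6² (b ≤ 5)}` on the first 13 codes (the top-bit block of the PURE decreasing split of
`SMV(7)`) is nonsingular and has a relaxed certificate found in 5 search nodes, but no triangular top-only certificate was found in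
`≈ 5·10⁴` search nodes (24 vertex orders per node, 3 seeds); with relaxed leaves the certificate search for the root needs 13–1 191 nodes for
every `h ≤ 24` (diagonal leaves: up to `2.4·10⁴`).  The node is therefore the weakest registrable text of the split-certificate family.

WHAT THIS IS NOT: no stub of the line is closed; each instance of the node is still a finite search plus one `O(n³)` modular check; nothing
on crux stmt-ValiantsHypothesis-14610 or on `VP` versus `VNP`.
-/

set_option linter.dupNamespace false
set_option autoImplicit false

namespace Summit.ValiantsHypothesis.ValiantsHypothesis.Theorems.BarrierLever.ChowBenchmarkSplit

open Finset
open Summit.ValiantsHypothesis.ValiantsHypothesis.Theorems.BarrierLever.MoorePeel (benchCols windowStart windowStart_succ_le_two_pow)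
open Summit.ValiantsHypothesis.ValiantsHypothesis.Theorems.BarrierLever.ChowFactor (invCertCheck det_ne_zero_of_invCertCheck)

namespace Cert

variable {p k n : ℕ}

/-! ## 1. The determinant leaf -/

/-- The scalar matrix `(s_ij)` of an instance, as integer row lists. -/
def scalRows (n : ℕ) (I : Inst) : List (List ℤ) :=
  (List.range n).map fun i => (List.range n).map fun j => ((I.entL i j).1 : ℤ)

/-- Reading the scalar lists back. -/
theorem scalRows_getD (I : Inst) (i j : Fin n) :
    ((scalRows n I).getD (i : ℕ) []).getD (j : ℕ) 0 = ((I.entL i j).1 : ℤ) := by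
  simp [scalRows, List.getD_eq_getElem?_getD, i.2, j.2]

/-- **The determinant leaf**: every column code is `0` (the entries are the bare scalars) and the scalar matrix has an inverse
certificate modulo `q > 1` (`LBt` = the columns of the inverse, as rows). -/
def leafOKDet (n q : ℕ) (LBt : List (List ℤ)) (I : Inst) : Bool :=
  decide (1 < q) && ((List.range n).all fun j => decide (I.colN j = 0)) && invCertCheck n q (scalRows n I) LBt

/-- **Soundness of the determinant leaf**: the matrix at the generic table is the scalar matrix (cast), whose determinant is a
nonzero integer. -/
theorem leafDet_sound (I : Inst) (q : ℕ) (LBt : List (List ℤ)) (hok : leafOKDet n q LBt I = true) :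
    (I.matrix p k n (G p k)).det ≠ 0 := by
  classical
  simp only [leafOKDet, Bool.and_eq_true, decide_eq_true_eq, List.all_eq_true, List.mem_range] at hok
  obtain ⟨⟨hq, hcol⟩, hinv⟩ := hok
  set A : Matrix (Fin n) (Fin n) ℤ := Matrix.of fun i j => ((I.entL i j).1 : ℤ) with hAdef
  have hA : ∀ i j : Fin n, A i j = ((scalRows n I).getD (i : ℕ) []).getD (j : ℕ) 0 := fun i j => by
    rw [scalRows_getD, hAdef, Matrix.of_apply]
  have hdetA : A.det ≠ 0 := det_ne_zero_of_invCertCheck hq A _ LBt hA hinv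
  have hM : I.matrix p k n (G p k) = (Int.castRingHom (MvPolynomial (Fin p × Fin k) ℂ)).mapMatrix A := by
    refine Matrix.ext fun i j => ?_
    rw [Inst.matrix, Matrix.of_apply, RingHom.mapMatrix_apply, Matrix.map_apply, hAdef, Matrix.of_apply, hcol j j.2, Tof_zero,
      dirE_empty_col, mul_one, eq_intCast, Int.cast_natCast]
  rw [hM, ← RingHom.map_det, eq_intCast]
  exact_mod_cast hdetA

/-! ## 2. The relaxed checker and its soundness -/

/-- **THE RELAXED CHECKER**: the levels of `check`, then EITHER the diagonal leaf OR the determinant leaf. -/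
def checkD (k n q : ℕ) (LBt : List (List ℤ)) : List Level → Inst → Bool
  | [], I => leafOK n I || leafOKDet n q LBt I
  | Level.perm σ :: ls, I => (permStep n σ I).1 && checkD k n q LBt ls (permStep n σ I).2
  | Level.split c lab ords α β :: ls, I =>
      (splitStep k n c lab ords α β I).1 && checkD k n q LBt ls (splitStep k n c lab ords α β I).2

/-- Every (triangular) certificate of `check` passes `checkD` (with any modulus and any inverse lists). -/
theorem checkD_of_check (q : ℕ) (LBt : List (List ℤ)) :
    ∀ (ls : List Level) (I : Inst), check k n ls I = true → checkD k n q LBt ls I = true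
  | [], I, h => by rw [checkD, Bool.or_eq_true]; exact Or.inl h
  | Level.perm σ :: ls, I, h => by
    rw [check, Bool.and_eq_true] at h
    rw [checkD, Bool.and_eq_true]
    exact ⟨h.1, checkD_of_check q LBt ls _ h.2⟩
  | Level.split c lab ords α β :: ls, I, h => by
    rw [check, Bool.and_eq_true] at h
    rw [checkD, Bool.and_eq_true]
    exact ⟨h.1, checkD_of_check q LBt ls _ h.2⟩

/-- **SOUNDNESS OF THE RELAXED CHECKER**: a certified instance has nonzero determinant at the generic table. -/
theorem det_genTable_ne_zero_of_checkD (q : ℕ) (LBt : List (List ℤ)) :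
    ∀ (ls : List Level) (I : Inst), supOK p n I = true → checkD k n q LBt ls I = true → (I.matrix p k n (G p k)).det ≠ 0
  | [], I, _, h => by
    rw [checkD, Bool.or_eq_true] at h
    rcases h with h | h
    · exact leaf_sound I h
    · exact leafDet_sound I q LBt h
  | Level.perm σ :: ls, I, hs, h => by
    rw [checkD, Bool.and_eq_true] at h
    exact permStep_sound σ I h.1 (det_genTable_ne_zero_of_checkD q LBt ls _ hs h.2)
  | Level.split c lab ords α β :: ls, I, hs, h => by
    rw [checkD, Bool.and_eq_true] at h
    exact splitStep_sound c lab ords α β I hs h.1 (det_genTable_ne_zero_of_checkD q LBt ls _ hs h.2)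

/-- **SOUNDNESS, existence form**: some complex table makes a certified instance nonsingular. -/
theorem exists_table_of_checkD (q : ℕ) (LBt : List (List ℤ)) (ls : List Level) (I : Inst) (hs : supOK p n I = true)
    (h : checkD k n q LBt ls I = true) : ∃ P : Fin p → Fin k → ℂ, (I.matrix p k n P).det ≠ 0 := by
  classical
  have hD := det_genTable_ne_zero_of_checkD q LBt ls I hs h
  by_contra hall
  push Not at hall
  apply hD
  apply MvPolynomial.funext
  intro x
  rw [map_zero, RingHom.map_det]
  have e : (MvPolynomial.eval x).mapMatrix (I.matrix p k n (G p k)) = I.matrix p k n (fun a c => x (a, c)) := by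
    refine Matrix.ext fun i j => ?_
    rw [RingHom.mapMatrix_apply, Matrix.map_apply, Inst.matrix, Inst.matrix, Matrix.of_apply, Matrix.of_apply, map_mul,
      map_natCast, map_dirE]
    congr 1
    exact dirE_congr _ _ fun a d _ => by simp [G, genT]
  rw [e]
  exact hall _

/-- **A relaxed certificate for the homogeneous root gives `HSMVAt h`.** -/
theorem hsmv_of_checkD (h q : ℕ) (LBt : List (List ℤ)) (ls : List Level)
    (hc : checkD h (windowStart (h + 1)) q LBt ls (rootInstW (hRows h) hWts (windowStart (h + 1))) = true) : HSMVAt h := by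
  obtain ⟨P, hP⟩ := exists_table_of_checkD (p := h + 1) (k := h) q LBt ls _ (supOK_of_spec (hRows_spec h)) hc
  refine ⟨P, ?_⟩
  rwa [rootInstW_matrix (hRows h) hWts (windowStart_succ_le_two_pow h)] at hP

end Cert

/-! ## 3. The typed node and its arrow -/

section Node

/-- **TYPED NODE — «every height has a RELAXED split certificate for the canonical homogeneous root»**: some levels (column permutations /
one-coordinate splits with per-component vertex orders and potentials) followed by a modular inverse certificate for the integer leaf matrix
pass `Cert.checkD`.  Each instance is a finite search plus an `O(n³)` check; weaker than `Stmt.splitCertCanon`. -/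
def Stmt.splitCertDet : Prop :=
  ∀ h : ℕ, ∃ (ls : List Cert.Level) (q : ℕ) (LBt : List (List ℤ)),
    Cert.checkD h (windowStart (h + 1)) q LBt ls (Cert.rootInstW (Cert.hRows h) Cert.hWts (windowStart (h + 1))) = true

/-- The triangular-certificate node implies the relaxed one. -/
theorem splitCertDet_of_splitCertCanon (H : Stmt.splitCertCanon) : Stmt.splitCertDet := by
  intro h
  obtain ⟨ls, hls⟩ := H h
  exact ⟨ls, 2, [], Cert.checkD_of_check 2 [] ls _ hls⟩

/-- **ARROW: the relaxed node implies `∀ h, SegmentMeanValueAt h`** (the registered stub `stub_segmentMeanValue`, verbatim). -/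
theorem segmentMeanValue_of_splitCertDet (H : Stmt.splitCertDet) : ∀ h : ℕ,
    ∀ (r : ℕ) (u : Fin r → Finset (Fin h)), Function.Injective u → (∀ i, (u i).card ≤ 2) →
      (∀ S : Finset (Fin h), S.card ≤ 2 → ∃ i, u i = S) →
      ∃ P : Fin h → Fin h → ℂ,
        (Matrix.of fun i j : Fin r =>
          ∑ g : (↥(benchCols h r j) → ↥(u i)), (∏ c : ↥(benchCols h r j), P (g c) c) *
            ∏ a : ↥(u i),
              ((Finset.univ.filter fun c : ↥(benchCols h r j) => g c = a).card.factorial : ℂ)).det ≠ 0 := by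
  intro h
  obtain ⟨ls, q, LBt, hls⟩ := H h
  exact smv_of_hsmv (Cert.hsmv_of_checkD h q LBt ls hls)

end Node

end Summit.ValiantsHypothesis.ValiantsHypothesis.Theorems.BarrierLever.ChowBenchmarkSplit
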